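import Summits.BirchSwinnertonDyer.BirchSwinnertonDyer.Theorems.ThetaPartnerAtTwoSignedTransportAtTwoStubSel2L0
import Summits.BirchSwinnertonDyer.BirchSwinnertonDyer.Theorems.ThetaPartnerAtTwoSignedTransportAtTwoStubSel2F
import HarnessLib

/-!
# The `μ`-TRANSPORT AT `2` ALONG A `2`-CONGRUENCE, CM-FREE — part 1 (the `A`-side of the residual devissage): the landed TP2
# theorems `stub_sel2L0` / `stub_sel2F` (route `ThetaPartnerAtTwo`, crux K1 `SignedTransportAtTwo`, lead bsd-wall-tp2-p1) with their
# UNUSED theta-habitat prefix (`¬ W.HasCM`, `W.analyticRank = 0`, `A.HasCM`, the `W[2] ≃ A[2]` datum, good-ss clauses) REMOVED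
# (seat `bsd-2adic-ss-1x` GEN 6; crux `SupersingularRankZeroAtTwo` 19097, unit-anchor road)

HONEST FRAMING (cells `bsd-2adic` / `bsd-wall`): THEOREMS ONLY — no definition, no named fact, no instance, no `sorry`; the two proofs
are VERBATIM those of `Theorems/ThetaPartnerAtTwoSignedTransportAtTwoStubSel2L0.lean` (p553187) and `…StubSel2F.lean`, whose
statements carry route TP2's habitat prefix although the proofs never use it (the binders are introduced and ignored). Restating them
prefix-free makes the `μ`-transport at `2` available OFF the theta habitat — for pairs of NON-CM curves (the unit-anchor road of crux
19097, 17 `a₂ = 0` classes) — see part 2 `…TwoCongruenceMuTransport`. Nothing about BSD; closes nothing; BSD is NOT proved by any of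
this. PARTITION (D-0054): X5@2 good-ss `a₂ = 0` × `p = 2` — types-the-object-of; bears_on: K4 19097 (UA road binder `hmuT`) · TP2 20333.

* `SignedTransportAtTwo.TwoCongruence.sel2L0_cmFree` — LOWER containment for any `A`.
* `SignedTransportAtTwo.TwoCongruence.sel2F_cmFree` — finiteness up the devissage for any `A`, any finite set of odd places.

References: [GreenbergVatsal2000] p. 3, Prop. (2.8); [BDKim2009] Prop. 2.10, Cor. 2.13; [Kobayashi2003] Def. 1.1; [GreenbergLNM1716] §3.
-/

set_option autoImplicit false
-- D-0017: single-problem summit, so `Summit.BirchSwinnertonDyer.BirchSwinnertonDyer.…` repeats a namespace BY DESIGN.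
set_option linter.dupNamespace false

noncomputable section

open scoped Classical AddSubgroup NNReal

open WeierstrassCurve NumberField IsDedekindDomain Field Literature Literature.NumberTheory.EllipticCurves
  Literature.NumberTheory.GaloisRepresentations Literature.NumberTheory.EllipticCurves.Kobayashi2003 ZpExtension
  Literature.NumberTheory.EllipticCurves.GreenbergVatsal2000 Literature.NumberTheory.EllipticCurves.GreenbergSelmer
  Literature.NumberTheory.EllipticCurves.Rank1Residual
  Summit.BirchSwinnertonDyer.Rank1Residual.Additive
  Summit.BirchSwinnertonDyer.Rank1Residual.X2.GreenbergVatsalUnramifiedAway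
  Summit.BirchSwinnertonDyer.BirchSwinnertonDyer.Theorems.FineSelmerLeSignedSelmer
  Summit.BirchSwinnertonDyer.Rank1Residual.Iwasawa

namespace Summit.BirchSwinnertonDyer.BirchSwinnertonDyer.Theorems.SignedTransportAtTwo
namespace TwoCongruence

universe u

/-- **LOWER containment of the residual devissage at `2`, CM-FREE** (the landed `stub_sel2L0`, p553187, with its unused
theta-habitat prefix removed — the proof is VERBATIM the lead's): for ANY elliptic `A/ℚ` (globally minimal model) and cyclotomic `κ`,
a residual class `c ∈ H¹(ℚ_∞, A[2^∞][2])` unramified at every odd place, residually trivial at `∞` and signed-Kummer above `2` has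
Kummer image in Kobayashi's `Sel⁺(A/ℚ_∞)`. [cite: GreenbergVatsal2000, p. 3 and Prop. (2.8)] [cite: BDKim2009, Prop. 2.10]
[cite: Kobayashi2003, Def. 1.1] -/
theorem sel2L0_cmFree :
    ∀ (A : WeierstrassCurve ℚ) [A.IsElliptic] [A.IsGloballyMinimal] (κ : ZpExtension ℚ 2), κ.IsCyclotomic →
    ∀ c : subgroupH1 κ.kerSubgroup ↥((↥(A.geomPrimaryTorsion 2))[(2 : ℤ)]),
      c ∈ unramifiedOutside κ.kerSubgroup ↥((↥(A.geomPrimaryTorsion 2))[(2 : ℤ)]) 2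
          (∅ : Set (HeightOneSpectrum (𝓞 ℚ))) →
      (∀ (w : InfinitePlace ℚ) (σ : Field.absoluteGaloisGroup ℚ),
          Literature.NumberTheory.EllipticCurves.conjH1 κ.kerSubgroup ↥((↥(A.geomPrimaryTorsion 2))[(2 : ℤ)]) σ c ∈
            GreenbergSelmer.infKer κ.kerSubgroup ↥((↥(A.geomPrimaryTorsion 2))[(2 : ℤ)]) w) →
      (∀ (v : HeightOneSpectrum (𝓞 ℚ)), ((2 : ℕ) : 𝓞 ℚ) ∈ v.asIdeal → ∀ σ : Field.absoluteGaloisGroup ℚ,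
          A.conjH1 2 κ.kerSubgroup σ
              (pushH1 κ.kerSubgroup ((↥(A.geomPrimaryTorsion 2))[(2 : ℤ)]).subtype (subtype_torsionBy_smul A 2) c) ∈
            localKummerOverOfEmb A 2 κ.kerSubgroup (closureEmb (K := ℚ) (v.adicCompletion ℚ))
              (⨆ n : ℕ, signedLocalPoints κ (v.adicCompletion ℚ) A 1 n)) →
      pushH1 κ.kerSubgroup ((↥(A.geomPrimaryTorsion 2))[(2 : ℤ)]).subtype (subtype_torsionBy_smul A 2) c ∈
        signedSelmerInfty A κ 1 := by
  intro A _ _ κ hκ c ha hb hc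
  -- Step 1′: the classical Selmer conditions over `ℚ_∞`
  have hsel := pushH1_mem_selmerInfty_of_unramified_conditions A κ hκ c ha hb hc
  -- `k(c) = hₙ(y)`; a topological generator `γ`
  obtain ⟨n, y, hy⟩ := exists_layerToInfty_eq A κ
    (pushH1 κ.kerSubgroup ((↥(A.geomPrimaryTorsion 2))[(2 : ℤ)]).subtype (subtype_torsionBy_smul A 2) c)
  obtain ⟨γ, hγ⟩ := κ.surjective (Multiplicative.ofAdd 1)
  have hγ' : κ.IsTopGenerator γ := hγ
  have hyA : y ∈ A.selmerInftyPreimage κ n := by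
    rw [A.mem_selmerInftyPreimage_iff κ n y, hy]; exact hsel
  -- the finite set `S = {bad places of A} ∪ {v ∣ 2}`
  have hT : ({v : HeightOneSpectrum (𝓞 ℚ) | ((2 : ℕ) : 𝓞 ℚ) ∈ v.asIdeal}).Finite :=
    BigGaloisRep.finite_setOf_natCast_mem_asIdeal (K := ℚ) two_ne_zero
  haveI : Fintype {v : HeightOneSpectrum (𝓞 ℚ) // ((2 : ℕ) : 𝓞 ℚ) ∈ v.asIdeal} := hT.fintype
  have hB : (A.badPlaces (𝓞 ℚ)).Finite := A.finite_badPlaces_holds (𝓞 ℚ)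
  set S : Finset (HeightOneSpectrum (𝓞 ℚ)) := hB.toFinset ∪ hT.toFinset with hSdef
  have hS : ∀ v ∉ S, ((2 : ℕ) : 𝓞 ℚ) ∉ v.asIdeal ∧ A.HasGoodReductionAt v := by
    intro v hv
    rw [hSdef, Finset.mem_union, not_or, Set.Finite.mem_toFinset, Set.Finite.mem_toFinset, Set.mem_setOf_eq] at hv
    refine ⟨hv.2, ?_⟩
    by_contra h
    exact hv.1 h
  -- descent of the classical local conditions at the places of `S`, for the `2ⁿ` conjugates `conj_{γ^i} y`
  have hcl := fun (vi : ↥S × Fin (2 ^ n)) ↦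
    exists_forall_resOfLe_localSubgroup_eq_zero_of_mem_localTowerKer A κ (vi.1.1.adicCompletion ℚ) n
      (A.localResOver_conjH1_mem_localTowerKer_of_mem κ hyA vi.1.1 (γ ^ (vi.2 : ℕ)))
  choose mc hmc using hcl
  -- descent of the signed Kummer witnesses at the places above `2`, for the same conjugates
  have hku := fun (vi : {v : HeightOneSpectrum (𝓞 ℚ) // ((2 : ℕ) : 𝓞 ℚ) ∈ v.asIdeal} × Fin (2 ^ n)) ↦
    exists_forall_conjH1_resOfLe_mem_localKummerOverOfEmb A κ (vi.1.1.adicCompletion ℚ)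
      (fun m ↦ signedLocalPoints κ (vi.1.1.adicCompletion ℚ) A 1 m)
      (signedLocalPointsOfEmb_mono κ (closureEmb (K := ℚ) (vi.1.1.adicCompletion ℚ)) A 1) y (γ ^ (vi.2 : ℕ))
      (by rw [hy]; exact hc vi.1.1 vi.1.2 _)
  choose mk hmk using hku
  -- one layer `m` past all of them
  set m : ℕ := max n (max (Finset.univ.sup mc) (Finset.univ.sup mk)) with hm
  have hnm : n ≤ m := le_max_left _ _
  have hmc' : ∀ vi, mc vi ≤ m := fun vi ↦
    (Finset.le_sup (Finset.mem_univ vi)).trans ((le_max_left _ _).trans (le_max_right _ _))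
  have hmk' : ∀ vi, mk vi ≤ m := fun vi ↦
    (Finset.le_sup (Finset.mem_univ vi)).trans ((le_max_right _ _).trans (le_max_right _ _))
  set ym : A.subgroupH1 2 (κ.layerSubgroup m) := A.resOfLe 2 (κ.layerSubgroup_antitone hnm) y with hym
  have hcm : A.layerToInfty κ m ym = A.layerToInfty κ n y := layerToInfty_resOfLe_layer A κ hnm y
  have hymA : ym ∈ A.selmerInftyPreimage κ m := by
    rw [A.mem_selmerInftyPreimage_iff, hcm, hy]; exact hsel
  -- `res_{K_m/K_n} y ∈ Sel⁺(A/ℚ_m)`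
  have hmem : ym ∈ signedSelmerLayer A κ 1 m := by
    rw [mem_signedSelmerLayer_iff]
    constructor
    · -- the classical local conditions at layer `m`
      change ym ∈ A.selmerGroupOver 2 (κ.layerSubgroup m)
      rw [WeierstrassCurve.mem_selmerGroupOver_iff]
      refine ⟨fun v σ ↦ ?_, fun w σ ↦ ?_⟩
      · rw [WeierstrassCurve.mem_localKerOver_iff]
        by_cases hv : v ∈ S
        · -- descended from `ℚ_∞`
          obtain ⟨i, hi, hiσ⟩ := exists_conjH1_eq_conjH1_pow_of_lt A κ hγ' n σ y
          rw [hym, conjH1_resOfLe_layer A κ hnm, hiσ, localResOver_resOfLe_layer A κ hnm]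
          exact hmc (⟨v, hv⟩, ⟨i, hi⟩) m hnm (hmc' _)
        · -- good odd `v ∉ S`: `𝒦_{v,m}[2^∞] = 0` (Greenberg's Lemma 3.3)
          have hK := A.localResOver_conjH1_mem_localTowerKer_of_mem κ hymA v σ
          obtain ⟨k, hk⟩ := A.exists_pow_smul_subgroupH1_layer_eq_zero κ m (A.conjH1 2 (κ.layerSubgroup m) σ ym)
          have hprim : A.localResOver 2 (κ.layerSubgroup m) (v.adicCompletion ℚ)
              (A.conjH1 2 (κ.layerSubgroup m) σ ym) ∈ A.localTowerKerPrimary κ (v.adicCompletion ℚ) m :=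
            (A.mem_localTowerKerPrimary_iff κ _ m _).2 ⟨hK, k, by rw [← map_nsmul, hk, map_zero]⟩
          rw [Greenberg1999.localTowerKerPrimary_eq_bot_of_hasGoodReductionAt A κ (hS v hv).1 (hS v hv).2 m,
            AddSubgroup.mem_bot] at hprim
          exact hprim
      · -- archimedean places split completely
        rw [WeierstrassCurve.mem_localKerOver_iff]
        have hK := A.localResOver_conjH1_mem_localTowerKer_of_mem_infinitePlace κ hymA w σ
        rw [A.localTowerKer_eq_bot_of_forall_mem κ w.Completion m
          (ZpExtension.resGal_infinitePlace_mem_kerSubgroup κ w), AddSubgroup.mem_bot] at hK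
        exact hK
    · -- the signed Kummer conditions at `v ∣ 2`: descended witnesses
      intro v hv σ
      obtain ⟨i, hi, hiσ⟩ := exists_conjH1_eq_conjH1_pow_of_lt A κ hγ' n σ y
      rw [hym, conjH1_resOfLe_layer A κ hnm, hiσ, ← conjH1_resOfLe_layer A κ hnm]
      exact hmk (⟨⟨v, hv⟩, ⟨i, hi⟩⟩) m hnm (hmk' _)
  -- `k(c) = h_m(res y) ∈ ⋃ₙ hₙ(Sel⁺(A/ℚ_n))`
  rw [← hy, ← hcm]
  exact map_layerToInfty_signedSelmerLayer_le A κ 1 m ⟨ym, hmem, rfl⟩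

/-- **Finiteness up the devissage at `2`, CM-FREE** (the landed `stub_sel2F` with its unused theta-habitat prefix and the unused
admissibility clauses removed — proof VERBATIM the lead's): for ANY elliptic `A/ℚ`, cyclotomic `κ` and finite set `S₀` of odd places,
finiteness of the residual group unramified at EVERY odd place (with the archimedean and signed conditions) implies finiteness of the
bigger group unramified outside `S₀` (each local quotient `H¹(I_η, A[2])` is finite and there are finitely many `η | v ∈ S₀` up to
`Γ`-conjugacy). [cite: GreenbergVatsal2000, Prop. (2.8)] [cite: BDKim2009, Prop. 2.10] -/
theorem sel2F_cmFree :
    ∀ (A : WeierstrassCurve ℚ) [A.IsElliptic] [A.IsGloballyMinimal] (κ : ZpExtension ℚ 2), κ.IsCyclotomic →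
    ∀ (S₀ : Finset (HeightOneSpectrum (𝓞 ℚ))), (∀ v ∈ S₀, ((2 : ℕ) : 𝓞 ℚ) ∉ v.asIdeal) →
    {c : subgroupH1 κ.kerSubgroup ↥((↥(A.geomPrimaryTorsion 2))[(2 : ℤ)]) |
      c ∈ unramifiedOutside κ.kerSubgroup ↥((↥(A.geomPrimaryTorsion 2))[(2 : ℤ)]) 2
          (∅ : Set (HeightOneSpectrum (𝓞 ℚ))) ∧
        (∀ (w : InfinitePlace ℚ) (σ : Field.absoluteGaloisGroup ℚ),
          Literature.NumberTheory.EllipticCurves.conjH1 κ.kerSubgroup ↥((↥(A.geomPrimaryTorsion 2))[(2 : ℤ)]) σ c ∈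
            GreenbergSelmer.infKer κ.kerSubgroup ↥((↥(A.geomPrimaryTorsion 2))[(2 : ℤ)]) w) ∧
        (∀ (v : HeightOneSpectrum (𝓞 ℚ)), ((2 : ℕ) : 𝓞 ℚ) ∈ v.asIdeal → ∀ σ : Field.absoluteGaloisGroup ℚ,
          A.conjH1 2 κ.kerSubgroup σ
              (pushH1 κ.kerSubgroup ((↥(A.geomPrimaryTorsion 2))[(2 : ℤ)]).subtype (subtype_torsionBy_smul A 2) c) ∈
            localKummerOverOfEmb A 2 κ.kerSubgroup (closureEmb (K := ℚ) (v.adicCompletion ℚ))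
              (⨆ n : ℕ, signedLocalPoints κ (v.adicCompletion ℚ) A 1 n))}.Finite →
    {c : subgroupH1 κ.kerSubgroup ↥((↥(A.geomPrimaryTorsion 2))[(2 : ℤ)]) |
      c ∈ unramifiedOutside κ.kerSubgroup ↥((↥(A.geomPrimaryTorsion 2))[(2 : ℤ)]) 2
          (↑S₀ : Set (HeightOneSpectrum (𝓞 ℚ))) ∧
        (∀ (w : InfinitePlace ℚ) (σ : Field.absoluteGaloisGroup ℚ),
          Literature.NumberTheory.EllipticCurves.conjH1 κ.kerSubgroup ↥((↥(A.geomPrimaryTorsion 2))[(2 : ℤ)]) σ c ∈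
            GreenbergSelmer.infKer κ.kerSubgroup ↥((↥(A.geomPrimaryTorsion 2))[(2 : ℤ)]) w) ∧
        (∀ (v : HeightOneSpectrum (𝓞 ℚ)), ((2 : ℕ) : 𝓞 ℚ) ∈ v.asIdeal → ∀ σ : Field.absoluteGaloisGroup ℚ,
          A.conjH1 2 κ.kerSubgroup σ
              (pushH1 κ.kerSubgroup ((↥(A.geomPrimaryTorsion 2))[(2 : ℤ)]).subtype (subtype_torsionBy_smul A 2) c) ∈
            localKummerOverOfEmb A 2 κ.kerSubgroup (closureEmb (K := ℚ) (v.adicCompletion ℚ))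
              (⨆ n : ℕ, signedLocalPoints κ (v.adicCompletion ℚ) A 1 n))}.Finite := by
  intro A _ _ κ hκ S₀ hS2 hfin
  obtain ⟨γ, hγ⟩ := κ.surjective (Multiplicative.ofAdd 1)
  have hγ' : κ.IsTopGenerator γ := hγ
  -- finitely many conjugates represent the places of `ℚ_∞` above each `v ∈ S₀`
  have hrep0 : ∀ v : ↥S₀, ∃ m : ℕ, ∀ σ : Field.absoluteGaloisGroup ℚ, ∃ n < 2 ^ m, ∃ δ ∈ decomp (K := ℚ) v.1,
      ∃ h ∈ κ.kerSubgroup, σ = h * (δ * γ ^ n) := fun v ↦ by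
    obtain ⟨δ₀, hδ₀, hne⟩ := exists_mem_decomp_apply_ne_one_of_isCyclotomic hκ (hS2 v.1 v.2)
    exact exists_forall_eq_mul_decomp_mul_pow κ hγ' hδ₀ hne
  choose N hN using hrep0
  set B : ℕ := 2 ^ (Finset.univ.sup N) with hB
  have hrep : ∀ (v : ↥S₀) (σ : Field.absoluteGaloisGroup ℚ), ∃ n < B, ∃ δ ∈ decomp (K := ℚ) v.1,
      ∃ h ∈ κ.kerSubgroup, σ = h * (δ * γ ^ n) := by
    intro v σ
    obtain ⟨n, hn, δ, hδ, h, hh, e⟩ := hN v σ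
    exact ⟨n, hn.trans_le (Nat.pow_le_pow_right Nat.two_pos (Finset.le_sup (Finset.mem_univ v))), δ, hδ, h, hh, e⟩
  -- the detecting map `Φ`
  let Φ : subgroupH1 κ.kerSubgroup ↥((↥(A.geomPrimaryTorsion 2))[(2 : ℤ)]) →
      ((vn : ↥S₀ × Fin B) → discreteH1 (inertiaIn κ.kerSubgroup vn.1.1) ↥((↥(A.geomPrimaryTorsion 2))[(2 : ℤ)])) :=
    fun c vn ↦ resH1Hom (inertiaInToH κ.kerSubgroup vn.1.1) (AddMonoidHom.id ↥((↥(A.geomPrimaryTorsion 2))[(2 : ℤ)])) (fun _ _ ↦ rfl)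
      (Literature.NumberTheory.EllipticCurves.conjH1 κ.kerSubgroup ↥((↥(A.geomPrimaryTorsion 2))[(2 : ℤ)]) (γ ^ (vn.2 : ℕ)) c)
  have hΦsub : ∀ c d, Φ (c - d) = Φ c - Φ d := by
    intro c d; funext vn; simp only [Φ, map_sub, Pi.sub_apply]
  -- its kernel consists of classes unramified at the places of `S₀`
  have hker : ∀ c, Φ c = 0 → ∀ v ∈ S₀, ∀ σ : Field.absoluteGaloisGroup ℚ,
      Literature.NumberTheory.EllipticCurves.conjH1 κ.kerSubgroup ↥((↥(A.geomPrimaryTorsion 2))[(2 : ℤ)]) σ c ∈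
        GreenbergVatsal2000.unramifiedKer κ.kerSubgroup ↥((↥(A.geomPrimaryTorsion 2))[(2 : ℤ)]) v := by
    intro c h0 v hv σ
    refine forall_conjH1_mem_unramifiedKer_of_forall_lt κ ↥((↥(A.geomPrimaryTorsion 2))[(2 : ℤ)]) (hrep ⟨v, hv⟩) (fun n hn ↦ ?_) σ
    exact congrFun h0 (⟨v, hv⟩, ⟨n, hn⟩)
  -- the target of `Φ` is finite
  haveI : ∀ vn : ↥S₀ × Fin B, Finite (discreteH1 (inertiaIn κ.kerSubgroup vn.1.1) ↥((↥(A.geomPrimaryTorsion 2))[(2 : ℤ)])) := fun vn ↦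
    finite_discreteH1_inertiaIn_torsionBy A 2 κ vn.1.1 (hS2 vn.1.1 vn.1.2)
  -- the two sets
  set X : Set (subgroupH1 κ.kerSubgroup ↥((↥(A.geomPrimaryTorsion 2))[(2 : ℤ)])) := {c |
      c ∈ unramifiedOutside κ.kerSubgroup ↥((↥(A.geomPrimaryTorsion 2))[(2 : ℤ)]) 2 (↑S₀ : Set (HeightOneSpectrum (𝓞 ℚ))) ∧
        (∀ (w : InfinitePlace ℚ) (σ : Field.absoluteGaloisGroup ℚ),
          Literature.NumberTheory.EllipticCurves.conjH1 κ.kerSubgroup ↥((↥(A.geomPrimaryTorsion 2))[(2 : ℤ)]) σ c ∈ GreenbergSelmer.infKer κ.kerSubgroup ↥((↥(A.geomPrimaryTorsion 2))[(2 : ℤ)]) w) ∧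
        (∀ (v : HeightOneSpectrum (𝓞 ℚ)), ((2 : ℕ) : 𝓞 ℚ) ∈ v.asIdeal → ∀ σ : Field.absoluteGaloisGroup ℚ,
          A.conjH1 2 κ.kerSubgroup σ
              (pushH1 κ.kerSubgroup ((↥(A.geomPrimaryTorsion 2))[(2 : ℤ)]).subtype (subtype_torsionBy_smul A 2) c) ∈
            localKummerOverOfEmb A 2 κ.kerSubgroup (closureEmb (K := ℚ) (v.adicCompletion ℚ))
              (⨆ n : ℕ, signedLocalPoints κ (v.adicCompletion ℚ) A 1 n))} with hX
  set Xb : Set (subgroupH1 κ.kerSubgroup ↥((↥(A.geomPrimaryTorsion 2))[(2 : ℤ)])) := {c |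
      c ∈ unramifiedOutside κ.kerSubgroup ↥((↥(A.geomPrimaryTorsion 2))[(2 : ℤ)]) 2 (∅ : Set (HeightOneSpectrum (𝓞 ℚ))) ∧
        (∀ (w : InfinitePlace ℚ) (σ : Field.absoluteGaloisGroup ℚ),
          Literature.NumberTheory.EllipticCurves.conjH1 κ.kerSubgroup ↥((↥(A.geomPrimaryTorsion 2))[(2 : ℤ)]) σ c ∈ GreenbergSelmer.infKer κ.kerSubgroup ↥((↥(A.geomPrimaryTorsion 2))[(2 : ℤ)]) w) ∧
        (∀ (v : HeightOneSpectrum (𝓞 ℚ)), ((2 : ℕ) : 𝓞 ℚ) ∈ v.asIdeal → ∀ σ : Field.absoluteGaloisGroup ℚ,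
          A.conjH1 2 κ.kerSubgroup σ
              (pushH1 κ.kerSubgroup ((↥(A.geomPrimaryTorsion 2))[(2 : ℤ)]).subtype (subtype_torsionBy_smul A 2) c) ∈
            localKummerOverOfEmb A 2 κ.kerSubgroup (closureEmb (K := ℚ) (v.adicCompletion ℚ))
              (⨆ n : ℕ, signedLocalPoints κ (v.adicCompletion ℚ) A 1 n))} with hXb
  change Xb.Finite at hfin
  change X.Finite
  -- `X` is closed under subtraction
  have hXsub : ∀ c ∈ X, ∀ d ∈ X, c - d ∈ X := by
    rintro c ⟨hca, hcb, hcc⟩ d ⟨hda, hdb, hdc⟩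
    refine ⟨sub_mem hca hda, fun w σ ↦ ?_, fun v hv σ ↦ ?_⟩
    · rw [map_sub]; exact sub_mem (hcb w σ) (hdb w σ)
    · rw [map_sub, map_sub]; exact sub_mem (hcc v hv σ) (hdc v hv σ)
  -- classes of `X` with the same `Φ`-value differ by an element of `X♭`
  have hdiff : ∀ c ∈ X, ∀ d ∈ X, Φ c = Φ d → c - d ∈ Xb := by
    intro c hc d hd hΦ
    have h0 : Φ (c - d) = 0 := by rw [hΦsub, hΦ, sub_self]
    obtain ⟨ha, hb, hc'⟩ := hXsub c hc d hd
    refine ⟨?_, hb, hc'⟩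
    rw [mem_unramifiedOutside_iff] at ha ⊢
    intro v _ hv2 σ
    by_cases hvS : v ∈ S₀
    · exact hker _ h0 v hvS σ
    · exact ha v hvS hv2 σ
  -- a section of `Φ` over `Φ(X)` and the covering `X ⊆ s(Φ X) + X♭`
  have himg : (Φ '' X).Finite := Set.toFinite _
  have hsec : ∀ t ∈ Φ '' X, ∃ c, c ∈ X ∧ Φ c = t := fun t ht ↦ ht
  choose! s hs using hsec
  have hsub : X ⊆ Set.image2 (· + ·) (s '' (Φ '' X)) Xb := by
    intro c hc
    have hct : Φ c ∈ Φ '' X := ⟨c, hc, rfl⟩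
    refine ⟨s (Φ c), ⟨Φ c, hct, rfl⟩, c - s (Φ c), hdiff c hc _ (hs _ hct).1 (hs _ hct).2.symm, ?_⟩
    abel
  exact ((himg.image s).image2 _ hfin).subset hsub

end TwoCongruence
end Summit.BirchSwinnertonDyer.BirchSwinnertonDyer.Theorems.SignedTransportAtTwo

end
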